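import Summits.QuantumFields.YangMills.Theorems.UnitScaleTiltProp7SymFrameLinearResponseStepT3
import Summits.QuantumFields.YangMills.Theorems.UnitScaleTiltProp7CombAccFrameStep
import Summits.QuantumFields.YangMills.Theorems.UnitScaleTiltProp7SymAvgTwFrameDiff
import Literature.MathematicalPhysics.QuantumFieldTheory.Balaban1983to89.B7Prop3GeneralLinear
import Literature.MathematicalPhysics.QuantumFieldTheory.Balaban1983to89.B7GaugeFixingAtBackground
import HarnessLib

/-!
# Route `UnitScaleTilt`, crux K1 «MinimiserStabilityRegPr» (stmt-QuantumFields-19200), route-R E′ (A′)-on-Σ, P-A2-COMB (β), item «R0-RECURSION» (★★OWNER RULINGS №19∕№20; px13 g6's pen,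
# R0-DOOR `(R0) ⟸ Φᶜ + Φˢ + REM2ˢ + REM2ᶜ`), sub-brick R0-LIN-C — THE LINEAR RESPONSE OF PRINT's COMB ACCUMULATED FRAMES `v_j = vcov` ((97) of [Balaban1985Averaging]), LEVEL BY LEVEL:
# `D v_{j+1}(z) = (Lᵈ)⁻¹ Σ_r ( D R_r(L•z) + Ū₀ʲ(Γ_r) · D v_j(L•z + r) · Ū₀ʲ(Γ_r)⁻¹ )` — the centre frame cancels EXACTLY at first order — and, at the top, `D(frameTw W · y)(0) = D v_{K−n}(coordT3 y)(0)`

Cell `ym3-torus`, twin-width seat `ym-routeR-w2` (gen 9); the COMB twin of ✓`Prop7SymFrameLinearResponseStep` (R0-LIN-S), per px13 g6 05:30:28Z «R0-LIN: GO, ABSTRACT-ℓ FORM, ONE TOWER AT A TIME».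
THEOREMS ONLY (0 `def`, 0 `sorry`); `--supports stmt-QuantumFields-19200 --as helper`, count-neutral.  YM₃ on T³ is a ladder rung (R3), not the Clay problem; nothing here claims the stub, the
crux, (β), `hPA2`, `hcoS`, d = 4 or the mass gap.

THE POINT.  The comb accumulated frame of the (β) door, `frameTw F n K h W A y = wrec … = vcov L (U₀♯) ((e^{A})♯) (K − n) (coordT3 y)` (✓`Prop7SymAvgTwFrameDiff.frameTw_eq_vcov`), obeys (97)
`v_{j+1}(z) = v_j(L•z) · w(Ū₀ʲ, U̿₁ʲ)(L•z)` (lit ✓`B7Eq92Concrete.vcov_succ`), read by ★routeR-w6 F1 ✓`Prop7CombAccFrameStep.coe_vcov_succ_eq` as `v_j(L•z) · eml_r( v_j(L•z)⁻¹ · R_r · a_r )`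
with the SINGLE-BAR tree ratio `R_r = (R_{0,L•z}Ũ₁ʲ)(Γ_r) = tHol (avgIter L U₀ j) (tildIter L U₀ U₁ j) (L•z) (treeWord (boxVec L r))` of PRINT's comb tower and the rotated end frame
`a_r = Rc (Ū₀ʲ(Γ_r)) (v_j(L•z + r))`.  Differentiating at a base point where the perturbation family passes through `U₁ = 1` (every frame and every tree ratio `= 1` there, §1) with
✓R0-LIN-S's `hasFDerivAt_mul_eml_inv_mul_of_eq_one` gives §3: THE derivatives satisfy the comb `ℓ`-recursion `ℓ_{j+1}(z) = (Lᵈ)⁻¹ Σ_r (ℓR_r(L•z) + Ad_{Ū₀ʲ(Γ_r)} ℓ_j(L•z + r))` — the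
linear bookkeeping of the one-tower second-order recursion for REM2ᶜ = `Σ_y ‖↑(frameTw W A y) − 1 − fderiv ℂ (A ↦ ↑(frameTw W A y)) 0 A‖` (R0-DOOR ✓`Prop7R0OfFrameRows.siteRow_of_frameRows`,
row `hrc`) and of the admitted route-internal row `hMcomb₂` (RULING №20 (1), SIGNATURE-0′ 53b55878: second-order remainder of `Ũ₁ˡ` with THE Fréchet derivative subtracted), whose summands'
linear parts are `fderiv ℂ (A′ ↦ ↑(tildIter … (pull (e^{A′}) x₀) l ẑ κ)) 0` — the bond values whose tree holonomies are the `R_r` above.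
* §1 base point (generic `ℤᵈ`, any `L`, any background `U₀`, any complete normed ℂ-algebra): `dbavgCovIter_unit_right`, `wframe_tower_unit_right`, `vcov_unit_right`, `tHol_unit_right`,
  `tildIter`∕`tHol` of the unit perturbation are `1` (lit ✓`B7Prop3GeneralLinear.dbavgCov_one_right`∕`wframe_one_right`, ✓`B7GaugeFixingAtBackground.tildIter_one_right`).
* §2 `differentiableAt_coe_hol` (the `ℤᵈ` twin of ✓`Prop8Chart.differentiableAt_coe_holT`), `differentiableAt_combTreeRatio` (tree ratios differentiable as soon as the single-bar tower's
  bonds `t ↦ ↑(tildIter L U₀ (U₁ t) j z κ)` are).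
* §3 ★★★ `hasFDerivAt_coe_vcov_succ` (meanCLM form, any candidate derivatives), ★★ `hasFDerivAt_coe_wframe_succ` (the ONE-STEP comb frame: value `1` ∧ derivative `… − ℓ_j(L•z)`),
  ★★★ `fderiv_coe_vcov_succ_apply` ∕ ★★ `fderiv_coe_wframe_succ_apply` (applied forms = the comb `ℓ`-recursion at a fixed direction, `ℓ := fderiv`), `differentiableAt_coe_vcov_succ`.
* §4 member: `frameTw_family_eq` ∕ ★ `fderiv_frameTw_eq_fderiv_vcov` — `fderiv ℂ (A ↦ ↑(frameTw F n K h W A y)) 0` IS the derivative at `0` of §3's family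
  `A ↦ ↑(vcov L (pull (bgUnits W) x₀) (pull (e^{A}) x₀) (K − n) (coordT3 y))`, base point `pull (e^{0}) x₀ = 1` (`comb_family_zero`) — R0-DOOR's `hrc` linear part is the `j = K − n` instance.
HONEST SCOPE.  Calculus and bookkeeping; differentiability of the single-bar tower ∕ of the accumulated comb frames enters as DISPLAYED hypotheses (lit ✓`B7Prop7OneStepAnalytic.analyticAt_tHol_family`
∕ ✓`Prop7SymAvgTwFrameBound.analyticAt_frameTw_of_mem_ball`-class rows discharge them at the member under the (β) lane's windows — not re-derived here); NO second-order term, no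
smallness, no currency; nothing of print asserted beyond its identities certified in lit; (R0), REM2ᶜ, `hMcomb₂`, (β), `hD`, `hPA2`, `hcoS`, the stub and the crux are NOT advanced analytically.

References: T. Bałaban, CMP 98 (1985) 17–51 [Balaban1985Averaging] ((9) p.18, (58) p.27, (69) p.29, (82) p.30, (85)–(92) p.31, (97)–(99) p.32); CMP 109 (1987) 249–301 [Balaban1987RG1]
((0.4)–(0.8) p.253); CMP 99 (1985) 389–434 [Balaban1985BackgroundPropagators] ((3.14) p.393).
-/

set_option autoImplicit false

noncomputable section

open scoped Matrix.Norms.L2Operator BigOperators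

namespace Summit.QuantumFields.YangMills.Theorems.Prop7CombFrameLinearResponseStep

open NormedSpace
open Literature.MathematicalPhysics.QuantumFieldTheory.Balaban1983to89
open ExpMeanLog (eml)
open B7Prop1Explicit (hol hol_nil hol_cons stepHol disp treeWord disp_treeWord boxVec expUnit Letter)
open B7Prop2Explicit (avgIter)
open B7Eq92Concrete (Rc Rc_apply tHol vcov vcov_succ vcov_zero wframe dbavgCovIter dbavgCovIter_succ dbavgCovIter_zero dbavgCov tildIter)
open B7GaugeFixingAtBackground (tildIter_one_right)
open Summit.QuantumFields.YangMills.Theorems.Prop7CombAccFrameStep (coe_vcov_succ_eq)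
open Summit.QuantumFields.YangMills.Theorems.Prop7SymFrameLinearResponseStep (hasFDerivAt_coe_inv_of_eq_one hasFDerivAt_coe_inv_mul_of_eq_one hasFDerivAt_mul_of_eq_one
  hasFDerivAt_conj hasFDerivAt_mul_eml_inv_mul_of_eq_one)

variable {E : Type*} [NormedAddCommGroup E] [NormedSpace ℂ E]
  {𝔸 : Type*} [NormedRing 𝔸] [NormedAlgebra ℂ 𝔸] [CompleteSpace 𝔸]
variable {d : ℕ}

/-! ## §1 The base point: every comb frame and every tree ratio of the unit perturbation is `1` -/

/-- **`U̿₁ʲ = 1` AT `U₁ = 1`**, every level `j`, every background `U₀` ((90)–(91) with lit ✓`B7Prop3GeneralLinear.dbavgCov_one_right`; generic-`𝔸` twin of the T⁴ spine's matrix-valued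
`NE3.PairLandauB8Avg.dbavgCovIter_one_right`). [cite: Balaban1985Averaging, (89)–(91) p.31] -/
theorem dbavgCovIter_unit_right (L : ℕ) (U₀ : B7Prop1Explicit.Site d → Fin d → 𝔸ˣ) :
    ∀ j : ℕ, dbavgCovIter L U₀ (1 : B7Prop1Explicit.Site d → Fin d → 𝔸ˣ) j = 1
  | 0 => rfl
  | j + 1 => by
    funext z κ
    rw [dbavgCovIter_succ, dbavgCovIter_unit_right L U₀ j, B7Prop3GeneralLinear.dbavgCov_one_right]
    rfl

/-- **THE ONE-STEP COMB FRAME OF THE UNIT TOWER IS `1`**: `w(Ū₀ʲ, U̿₁ʲ) = 1` at `U₁ = 1` ((82) ∘ `dbavgCovIter_unit_right` ∘ lit ✓`wframe_one_right`). [cite: Balaban1985Averaging, (82) p.30, (91) p.31] -/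
theorem wframe_tower_unit_right (L : ℕ) (U₀ : B7Prop1Explicit.Site d → Fin d → 𝔸ˣ) (j : ℕ) (y : B7Prop1Explicit.Site d) :
    wframe L (avgIter L U₀ j) (dbavgCovIter L U₀ (1 : B7Prop1Explicit.Site d → Fin d → 𝔸ˣ) j) y = 1 := by
  rw [dbavgCovIter_unit_right, B7Prop3GeneralLinear.wframe_one_right]

/-- **THE COMB ACCUMULATED FRAME OF THE UNIT PERTURBATION IS `1`**: `v_j(U₀; 1) = 1` ((97) by induction; lit ✓`B7GaugeFixingAtBackground.wrec_one_right` is the `wrec` edition).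
[cite: Balaban1985Averaging, (97) p.32] -/
theorem vcov_unit_right (L : ℕ) (U₀ : B7Prop1Explicit.Site d → Fin d → 𝔸ˣ) :
    ∀ (j : ℕ) (z : B7Prop1Explicit.Site d), vcov L U₀ (1 : B7Prop1Explicit.Site d → Fin d → 𝔸ˣ) j z = 1
  | 0, _ => rfl
  | j + 1, z => by rw [vcov_succ, vcov_unit_right L U₀ j, wframe_tower_unit_right, one_mul]

omit [NormedAlgebra ℂ 𝔸] [CompleteSpace 𝔸] in
/-- **THE TWISTED TRANSPORT (58) OF THE UNIT CONFIGURATION IS `1`**: `(R_{0,y}1)(Γ) = (1·V₀)(Γ)·V₀(Γ)⁻¹ = 1`. [cite: Balaban1985Averaging, (58) p.27] -/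
theorem tHol_unit_right (V₀ : B7Prop1Explicit.Site d → Fin d → 𝔸ˣ) (y : B7Prop1Explicit.Site d) (w : List (Letter d)) :
    tHol V₀ (1 : B7Prop1Explicit.Site d → Fin d → 𝔸ˣ) y w = 1 := by
  rw [tHol, one_mul, mul_inv_cancel]

/-- **THE SINGLE-BAR TREE RATIOS OF THE UNIT PERTURBATION ARE `1`**: `(R_{0,y}Ũ₁ʲ)(Γ) = 1` at `U₁ = 1` ((69): `Ũ₁ʲ = 1`, lit ✓`tildIter_one_right`). [cite: Balaban1985Averaging, (69) p.29, (58) p.27] -/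
theorem tHol_tildIter_unit_right (L : ℕ) (U₀ : B7Prop1Explicit.Site d → Fin d → 𝔸ˣ) (j : ℕ) (y : B7Prop1Explicit.Site d) (w : List (Letter d)) :
    tHol (avgIter L U₀ j) (tildIter L U₀ (1 : B7Prop1Explicit.Site d → Fin d → 𝔸ˣ) j) y w = 1 := by
  rw [tildIter_one_right, tHol_unit_right]

/-! ## §2 Differentiability of lattice holonomies and of the comb tree ratios -/

/-- **THE `ℤᵈ` HOLONOMY OF A DIFFERENTIABLE UNIT FAMILY IS DIFFERENTIABLE** (finite products of bond variables and their inverses; the `ℤᵈ` twin of ✓`Prop8Chart.differentiableAt_coe_holT`).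
[cite: Balaban1985Averaging, (9) p.18] -/
theorem differentiableAt_coe_hol {Z : E → B7Prop1Explicit.Site d → Fin d → 𝔸ˣ} {a : E}
    (hZ : ∀ x μ, DifferentiableAt ℂ (fun t => ((Z t x μ : 𝔸ˣ) : 𝔸)) a) :
    ∀ (w : List (Letter d)) (x : B7Prop1Explicit.Site d), DifferentiableAt ℂ (fun t => ((hol (Z t) x w : 𝔸ˣ) : 𝔸)) a
  | [], x => by simp only [hol_nil, Units.val_one]; exact differentiableAt_const _
  | (μ, b) :: w, x => by
    have ih := differentiableAt_coe_hol hZ w (x + Letter.vec (μ, b))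
    cases b
    · have h : (fun t => ((hol (Z t) x ((μ, false) :: w) : 𝔸ˣ) : 𝔸))
          = fun t => (((Z t (x - B7Prop1Explicit.e μ) μ)⁻¹ : 𝔸ˣ) : 𝔸) * ((hol (Z t) (x + Letter.vec (μ, false)) w : 𝔸ˣ) : 𝔸) := by
        funext t; rw [hol_cons, B7Prop1Explicit.stepHol_false, Units.val_mul]
      rw [h]
      exact (Prop8Chart.differentiableAt_coe_inv (hZ _ _)).mul ih
    · have h : (fun t => ((hol (Z t) x ((μ, true) :: w) : 𝔸ˣ) : 𝔸))
          = fun t => ((Z t x μ : 𝔸ˣ) : 𝔸) * ((hol (Z t) (x + Letter.vec (μ, true)) w : 𝔸ˣ) : 𝔸) := by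
        funext t; rw [hol_cons, B7Prop1Explicit.stepHol_true, Units.val_mul]
      rw [h]
      exact (hZ _ _).mul ih

/-- **THE COMB TREE RATIOS ARE DIFFERENTIABLE AS SOON AS THE SINGLE-BAR TOWER'S BONDS ARE**: `t ↦ (R_{0,y}Ũ₁ʲ(t))(Γ) = (Ũ₁ʲ(t)·Ū₀ʲ)(Γ)·Ū₀ʲ(Γ)⁻¹` (the background leg is constant).
[cite: Balaban1985Averaging, (58) p.27, (69) p.29] -/
theorem differentiableAt_combTreeRatio (L : ℕ) (U₀ : B7Prop1Explicit.Site d → Fin d → 𝔸ˣ) (U₁ : E → B7Prop1Explicit.Site d → Fin d → 𝔸ˣ) {a : E} (j : ℕ)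
    (hT : ∀ x κ, DifferentiableAt ℂ (fun t => ((tildIter L U₀ (U₁ t) j x κ : 𝔸ˣ) : 𝔸)) a)
    (y : B7Prop1Explicit.Site d) (w : List (Letter d)) :
    DifferentiableAt ℂ (fun t => ((tHol (avgIter L U₀ j) (tildIter L U₀ (U₁ t) j) y w : 𝔸ˣ) : 𝔸)) a := by
  have heq : (fun t => ((tHol (avgIter L U₀ j) (tildIter L U₀ (U₁ t) j) y w : 𝔸ˣ) : 𝔸))
      = fun t => ((hol (tildIter L U₀ (U₁ t) j * avgIter L U₀ j) y w : 𝔸ˣ) : 𝔸) * (((hol (avgIter L U₀ j) y w)⁻¹ : 𝔸ˣ) : 𝔸) := by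
    funext t; rw [tHol, Units.val_mul]
  rw [heq]
  refine (differentiableAt_coe_hol (Z := fun t => tildIter L U₀ (U₁ t) j * avgIter L U₀ j) (fun x μ => ?_) w y).mul (differentiableAt_const _)
  have h2 : (fun t => (((tildIter L U₀ (U₁ t) j * avgIter L U₀ j) x μ : 𝔸ˣ) : 𝔸)) = fun t => ((tildIter L U₀ (U₁ t) j x μ : 𝔸ˣ) : 𝔸) * ((avgIter L U₀ j x μ : 𝔸ˣ) : 𝔸) := by
    funext t; rfl
  rw [h2]
  exact (hT x μ).mul (differentiableAt_const _)

/-! ## §3 ★★★ The comb tower: the derivative recursion of PRINT's accumulated frames -/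

section Tower

variable (L : ℕ) (U₀ : B7Prop1Explicit.Site d → Fin d → 𝔸ˣ) (U₁ : E → B7Prop1Explicit.Site d → Fin d → 𝔸ˣ) {a : E}

/-- **LEVEL `0`**: `v_0 ≡ 1`, derivative `0`. [cite: Balaban1985Averaging, (97) p.32] -/
theorem hasFDerivAt_coe_vcov_zero (z : B7Prop1Explicit.Site d) :
    HasFDerivAt (fun t => (vcov L U₀ (U₁ t) 0 z : 𝔸)) (0 : E →L[ℂ] 𝔸) a := by
  have heq : (fun t => (vcov L U₀ (U₁ t) 0 z : 𝔸)) = fun _ => 1 := by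
    funext t; rw [vcov_zero, Units.val_one]
  rw [heq]
  exact hasFDerivAt_const _ _

/-- ★★★ **THE DERIVATIVE RECURSION OF PRINT's COMB ACCUMULATED FRAMES** ((97) ∘ ★routeR-w6 ✓`coe_vcov_succ_eq`, differentiated at a base point `U₁ a = 1` where every frame and every
tree ratio is `1`): if the tree ratios `t ↦ (R_{0,L•z}Ũ₁ʲ(t))(Γ_r)` have derivatives `ρ r`, the level-`j` frames at the box points `L•z + r` have `ℓ r` and at the corner `L•z` has `ℓ₀`,
then `t ↦ ↑(v_{j+1}(t)(z))` has derivative `(Lᵈ)⁻¹ Σ_r (ρ r + Ad_{Ū₀ʲ(Γ_r)} ∘ ℓ r)` — the corner response `ℓ₀` does not enter (`0 < L`).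
[cite: Balaban1985Averaging, (97) p.32, (85) p.31, (82) p.30, (58) p.27; Balaban1987RG1, (0.8) p.253] -/
theorem hasFDerivAt_coe_vcov_succ (hL : 0 < L) (hU₁ : U₁ a = 1) (j : ℕ) (z : B7Prop1Explicit.Site d)
    {ℓ₀ : E →L[ℂ] 𝔸} {ρ ℓ : (Fin d → Fin L) → E →L[ℂ] 𝔸}
    (h0 : HasFDerivAt (fun t => (vcov L U₀ (U₁ t) j ((L : ℤ) • z) : 𝔸)) ℓ₀ a)
    (hρ : ∀ r : Fin d → Fin L, HasFDerivAt (fun t => ((tHol (avgIter L U₀ j) (tildIter L U₀ (U₁ t) j) ((L : ℤ) • z) (treeWord (boxVec L r)) : 𝔸ˣ) : 𝔸)) (ρ r) a)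
    (hℓ : ∀ r : Fin d → Fin L, HasFDerivAt (fun t => (vcov L U₀ (U₁ t) j ((L : ℤ) • z + boxVec L r) : 𝔸)) (ℓ r) a) :
    HasFDerivAt (fun t => (vcov L U₀ (U₁ t) (j + 1) z : 𝔸))
      ((Fintype.card (Fin d → Fin L) : ℂ)⁻¹ • ∑ r : Fin d → Fin L,
        (ρ r + (ContinuousLinearMap.mulLeftRight ℂ 𝔸 ((hol (avgIter L U₀ j) ((L : ℤ) • z) (treeWord (boxVec L r)) : 𝔸ˣ) : 𝔸)
          (((hol (avgIter L U₀ j) ((L : ℤ) • z) (treeWord (boxVec L r)))⁻¹ : 𝔸ˣ) : 𝔸)).comp (ℓ r))) a := by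
  haveI : Nonempty (Fin d → Fin L) := ⟨fun _ => ⟨0, hL⟩⟩
  -- the factors `b_r t := R_r t · a_r t`
  set b : (Fin d → Fin L) → E → 𝔸 := fun r t =>
    ((tHol (avgIter L U₀ j) (tildIter L U₀ (U₁ t) j) ((L : ℤ) • z) (treeWord (boxVec L r)) : 𝔸ˣ) : 𝔸)
      * (((hol (avgIter L U₀ j) ((L : ℤ) • z) (treeWord (boxVec L r)) : 𝔸ˣ) : 𝔸) * (vcov L U₀ (U₁ t) j ((L : ℤ) • z + boxVec L r) : 𝔸)
        * (((hol (avgIter L U₀ j) ((L : ℤ) • z) (treeWord (boxVec L r)))⁻¹ : 𝔸ˣ) : 𝔸)) with hb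
  have heq : (fun t => (vcov L U₀ (U₁ t) (j + 1) z : 𝔸))
      = fun t => (vcov L U₀ (U₁ t) j ((L : ℤ) • z) : 𝔸) * eml (fun r => (((vcov L U₀ (U₁ t) j ((L : ℤ) • z))⁻¹ : 𝔸ˣ) : 𝔸) * b r t) := by
    funext t
    rw [coe_vcov_succ_eq]
    rfl
  rw [heq]
  -- values at the base point
  have hR1 : ∀ r : Fin d → Fin L, tHol (avgIter L U₀ j) (tildIter L U₀ (U₁ a) j) ((L : ℤ) • z) (treeWord (boxVec L r)) = 1 := fun r => by
    rw [hU₁, tHol_tildIter_unit_right]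
  have hv1 : vcov L U₀ (U₁ a) j ((L : ℤ) • z) = 1 := by rw [hU₁, vcov_unit_right]
  have ha1 : ∀ r : Fin d → Fin L, (vcov L U₀ (U₁ a) j ((L : ℤ) • z + boxVec L r) : 𝔸) = 1 := fun r => by
    rw [hU₁, vcov_unit_right, Units.val_one]
  have hb1 : ∀ r, b r a = 1 := fun r => by
    simp only [hb, hR1 r, ha1 r, Units.val_one, mul_one, Units.mul_inv]
  -- derivatives of the factors
  have hb' : ∀ r, HasFDerivAt (b r) (ρ r + (ContinuousLinearMap.mulLeftRight ℂ 𝔸 ((hol (avgIter L U₀ j) ((L : ℤ) • z) (treeWord (boxVec L r)) : 𝔸ˣ) : 𝔸)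
      (((hol (avgIter L U₀ j) ((L : ℤ) • z) (treeWord (boxVec L r)))⁻¹ : 𝔸ˣ) : 𝔸)).comp (ℓ r)) a := by
    intro r
    have ha' := hasFDerivAt_conj (hℓ r) (((hol (avgIter L U₀ j) ((L : ℤ) • z) (treeWord (boxVec L r)) : 𝔸ˣ) : 𝔸))
      ((((hol (avgIter L U₀ j) ((L : ℤ) • z) (treeWord (boxVec L r)))⁻¹ : 𝔸ˣ) : 𝔸))
    have hR1' : ((tHol (avgIter L U₀ j) (tildIter L U₀ (U₁ a) j) ((L : ℤ) • z) (treeWord (boxVec L r)) : 𝔸ˣ) : 𝔸) = 1 := by rw [hR1 r, Units.val_one]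
    have ha1' : (((hol (avgIter L U₀ j) ((L : ℤ) • z) (treeWord (boxVec L r)) : 𝔸ˣ) : 𝔸) * (vcov L U₀ (U₁ a) j ((L : ℤ) • z + boxVec L r) : 𝔸)
        * (((hol (avgIter L U₀ j) ((L : ℤ) • z) (treeWord (boxVec L r)))⁻¹ : 𝔸ˣ) : 𝔸)) = 1 := by
      rw [ha1 r, mul_one, Units.mul_inv]
    exact hasFDerivAt_mul_of_eq_one (hρ r) ha' hR1' ha1'
  exact hasFDerivAt_mul_eml_inv_mul_of_eq_one h0 hb' hv1 hb1

/-- ★★ **THE ONE-STEP COMB FRAME'S RESPONSE** (px13's (i), comb): `t ↦ ↑(w(Ū₀ʲ, U̿₁ʲ(t))(L•z))` takes the value `1` at `a` and has derivative `(Lᵈ)⁻¹ Σ_r (ρ r + Ad ∘ ℓ r) − ℓ₀` there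
((97): `w_j(L•z) = v_j(L•z)⁻¹ · v_{j+1}(z)`). [cite: Balaban1985Averaging, (82) p.30, (97) p.32] -/
theorem hasFDerivAt_coe_wframe_succ (hL : 0 < L) (hU₁ : U₁ a = 1) (j : ℕ) (z : B7Prop1Explicit.Site d)
    {ℓ₀ : E →L[ℂ] 𝔸} {ρ ℓ : (Fin d → Fin L) → E →L[ℂ] 𝔸}
    (h0 : HasFDerivAt (fun t => (vcov L U₀ (U₁ t) j ((L : ℤ) • z) : 𝔸)) ℓ₀ a)
    (hρ : ∀ r : Fin d → Fin L, HasFDerivAt (fun t => ((tHol (avgIter L U₀ j) (tildIter L U₀ (U₁ t) j) ((L : ℤ) • z) (treeWord (boxVec L r)) : 𝔸ˣ) : 𝔸)) (ρ r) a)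
    (hℓ : ∀ r : Fin d → Fin L, HasFDerivAt (fun t => (vcov L U₀ (U₁ t) j ((L : ℤ) • z + boxVec L r) : 𝔸)) (ℓ r) a) :
    wframe L (avgIter L U₀ j) (dbavgCovIter L U₀ (U₁ a) j) ((L : ℤ) • z) = 1 ∧
    HasFDerivAt (fun t => (wframe L (avgIter L U₀ j) (dbavgCovIter L U₀ (U₁ t) j) ((L : ℤ) • z) : 𝔸))
      ((Fintype.card (Fin d → Fin L) : ℂ)⁻¹ • ∑ r : Fin d → Fin L,
        (ρ r + (ContinuousLinearMap.mulLeftRight ℂ 𝔸 ((hol (avgIter L U₀ j) ((L : ℤ) • z) (treeWord (boxVec L r)) : 𝔸ˣ) : 𝔸)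
          (((hol (avgIter L U₀ j) ((L : ℤ) • z) (treeWord (boxVec L r)))⁻¹ : 𝔸ˣ) : 𝔸)).comp (ℓ r)) - ℓ₀) a := by
  refine ⟨by rw [hU₁, wframe_tower_unit_right], ?_⟩
  have heq : (fun t => (wframe L (avgIter L U₀ j) (dbavgCovIter L U₀ (U₁ t) j) ((L : ℤ) • z) : 𝔸))
      = fun t => (((vcov L U₀ (U₁ t) j ((L : ℤ) • z))⁻¹ * vcov L U₀ (U₁ t) (j + 1) z : 𝔸ˣ) : 𝔸) := by
    funext t; rw [vcov_succ, inv_mul_cancel_left]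
  rw [heq]
  have hv0 : vcov L U₀ (U₁ a) j ((L : ℤ) • z) = 1 := by rw [hU₁, vcov_unit_right]
  have hv1 : vcov L U₀ (U₁ a) (j + 1) z = 1 := by rw [hU₁, vcov_unit_right]
  exact hasFDerivAt_coe_inv_mul_of_eq_one h0 (hasFDerivAt_coe_vcov_succ L U₀ U₁ hL hU₁ j z h0 hρ hℓ) hv0 hv1

/-- ★★★ **APPLIED FORM AT A FIXED DIRECTION `A` — THE COMB `ℓ`-RECURSION FOR `ℓ := fderiv`** (`ℓj x := fderiv ℂ (t ↦ ↑(v_j(t)(x))) a A`, `ℓR z r := fderiv ℂ (t ↦ ↑((R_{0,L•z}Ũ₁ʲ(t))(Γ_r))) a A`),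
under differentiability of the single-bar tower's level-`j` bonds and of the level-`j` comb frames:
`fderiv ℂ (t ↦ ↑(v_{j+1}(t)(z))) a A = (Lᵈ)⁻¹ • Σ_r ( ℓR z r + Ū₀ʲ(Γ_r) · ℓj(L•z + r) · Ū₀ʲ(Γ_r)⁻¹ )`. [cite: Balaban1985Averaging, (97) p.32, (85) p.31; Balaban1987RG1, (0.8) p.253] -/
theorem fderiv_coe_vcov_succ_apply (hL : 0 < L) (hU₁ : U₁ a = 1) (j : ℕ)
    (hT : ∀ x κ, DifferentiableAt ℂ (fun t => ((tildIter L U₀ (U₁ t) j x κ : 𝔸ˣ) : 𝔸)) a)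
    (hF : ∀ x : B7Prop1Explicit.Site d, DifferentiableAt ℂ (fun t => (vcov L U₀ (U₁ t) j x : 𝔸)) a) (z : B7Prop1Explicit.Site d) (A : E) :
    fderiv ℂ (fun t => (vcov L U₀ (U₁ t) (j + 1) z : 𝔸)) a A
      = (Fintype.card (Fin d → Fin L) : ℂ)⁻¹ • ∑ r : Fin d → Fin L,
        (fderiv ℂ (fun t => ((tHol (avgIter L U₀ j) (tildIter L U₀ (U₁ t) j) ((L : ℤ) • z) (treeWord (boxVec L r)) : 𝔸ˣ) : 𝔸)) a A
          + ((hol (avgIter L U₀ j) ((L : ℤ) • z) (treeWord (boxVec L r)) : 𝔸ˣ) : 𝔸)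
            * fderiv ℂ (fun t => (vcov L U₀ (U₁ t) j ((L : ℤ) • z + boxVec L r) : 𝔸)) a A
            * (((hol (avgIter L U₀ j) ((L : ℤ) • z) (treeWord (boxVec L r)))⁻¹ : 𝔸ˣ) : 𝔸)) := by
  rw [(hasFDerivAt_coe_vcov_succ L U₀ U₁ hL hU₁ j z (hF _).hasFDerivAt (fun _ => (differentiableAt_combTreeRatio L U₀ U₁ j hT _ _).hasFDerivAt)
    (fun _ => (hF _).hasFDerivAt)).fderiv]
  simp only [smul_apply, sum_apply]
  rfl

/-- ★★ **THE ONE-STEP COMB FRAME, APPLIED FORM**: `fderiv ℂ (t ↦ ↑(w_j(t)(L•z))) a A = (Lᵈ)⁻¹ • Σ_r (ℓR z r + Ū₀ʲ(Γ_r)·ℓj(L•z + r)·Ū₀ʲ(Γ_r)⁻¹) − ℓj(L•z)` and `w_j(a)(L•z) = 1`.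
[cite: Balaban1985Averaging, (82) p.30, (97) p.32] -/
theorem fderiv_coe_wframe_succ_apply (hL : 0 < L) (hU₁ : U₁ a = 1) (j : ℕ)
    (hT : ∀ x κ, DifferentiableAt ℂ (fun t => ((tildIter L U₀ (U₁ t) j x κ : 𝔸ˣ) : 𝔸)) a)
    (hF : ∀ x : B7Prop1Explicit.Site d, DifferentiableAt ℂ (fun t => (vcov L U₀ (U₁ t) j x : 𝔸)) a) (z : B7Prop1Explicit.Site d) (A : E) :
    wframe L (avgIter L U₀ j) (dbavgCovIter L U₀ (U₁ a) j) ((L : ℤ) • z) = 1 ∧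
    fderiv ℂ (fun t => (wframe L (avgIter L U₀ j) (dbavgCovIter L U₀ (U₁ t) j) ((L : ℤ) • z) : 𝔸)) a A
      = (Fintype.card (Fin d → Fin L) : ℂ)⁻¹ • ∑ r : Fin d → Fin L,
        (fderiv ℂ (fun t => ((tHol (avgIter L U₀ j) (tildIter L U₀ (U₁ t) j) ((L : ℤ) • z) (treeWord (boxVec L r)) : 𝔸ˣ) : 𝔸)) a A
          + ((hol (avgIter L U₀ j) ((L : ℤ) • z) (treeWord (boxVec L r)) : 𝔸ˣ) : 𝔸)
            * fderiv ℂ (fun t => (vcov L U₀ (U₁ t) j ((L : ℤ) • z + boxVec L r) : 𝔸)) a A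
            * (((hol (avgIter L U₀ j) ((L : ℤ) • z) (treeWord (boxVec L r)))⁻¹ : 𝔸ˣ) : 𝔸))
        - fderiv ℂ (fun t => (vcov L U₀ (U₁ t) j ((L : ℤ) • z) : 𝔸)) a A := by
  have h := hasFDerivAt_coe_wframe_succ L U₀ U₁ hL hU₁ j z (hF _).hasFDerivAt (fun _ => (differentiableAt_combTreeRatio L U₀ U₁ j hT _ _).hasFDerivAt)
    (fun _ => (hF _).hasFDerivAt)
  refine ⟨h.1, ?_⟩
  rw [h.2.fderiv]
  simp only [sub_apply, smul_apply, sum_apply]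
  rfl

/-- **DIFFERENTIABILITY PROPAGATES UP THE COMB TOWER**: level-`j` single-bar bonds and level-`j` frames differentiable ⟹ level-`(j+1)` frames differentiable.
[cite: Balaban1985Averaging, (97) p.32] -/
theorem differentiableAt_coe_vcov_succ (hL : 0 < L) (hU₁ : U₁ a = 1) (j : ℕ)
    (hT : ∀ x κ, DifferentiableAt ℂ (fun t => ((tildIter L U₀ (U₁ t) j x κ : 𝔸ˣ) : 𝔸)) a)
    (hF : ∀ x : B7Prop1Explicit.Site d, DifferentiableAt ℂ (fun t => (vcov L U₀ (U₁ t) j x : 𝔸)) a) (z : B7Prop1Explicit.Site d) :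
    DifferentiableAt ℂ (fun t => (vcov L U₀ (U₁ t) (j + 1) z : 𝔸)) a :=
  (hasFDerivAt_coe_vcov_succ L U₀ U₁ hL hU₁ j z (hF _).hasFDerivAt (fun _ => (differentiableAt_combTreeRatio L U₀ U₁ j hT _ _).hasFDerivAt)
    (fun _ => (hF _).hasFDerivAt)).differentiableAt

end Tower

/-! ## §4 The member: the top of the comb recursion is `fderiv (frameTw W · y) 0` -/

section Member

open Literature.MathematicalPhysics.QuantumFieldTheory.Balaban1983to89.T3ContinuumYM3Torus
open T3SectALandauChart (bgUnits)
open B10Eq27TorusAxialLog (pull)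
open Summit.QuantumFields.YangMills.Theorems.Prop7SPrint (basePt)
open Summit.QuantumFields.YangMills.Theorems.Prop7SymAvgTw (coordT3 frameTw frameTw_def)
open B7Eq99Concrete (wrec_eq_vcov)

variable (F : T3Family) {n K : ℕ} (h : n ≤ K)

/-- **THE (β) DOOR'S COMB FRAME IS §3's ACCUMULATED FRAME OF THE FAMILY `A ↦ (e^{A})♯ = pull (e^{A}) x₀`** at level `K − n`, point `coordT3 y`, background `U₀♯ = pull (bgUnits W) x₀`
(✓`frameTw_def` ∘ lit ✓`wrec_eq_vcov`, as functions of `A`). [cite: Balaban1985Averaging, (97)–(99) p.32] -/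
theorem frameTw_family_eq (W : GaugeField (F.P K) 0 (Matrix.specialUnitaryGroup (Fin 2) ℂ)) (y : Site (F.P n) 0) :
    (fun A : PBond (F.P K) 0 → Matrix (Fin 2) (Fin 2) ℂ => ((frameTw F n K h W A y : (Matrix (Fin 2) (Fin 2) ℂ)ˣ) : Matrix (Fin 2) (Fin 2) ℂ))
      = fun A => ((vcov (F.P K).L (pull (bgUnits F K W) (basePt F n K)) (pull (fun b => expUnit (A b)) (basePt F n K)) (K - n) (coordT3 F n K h y) :
          (Matrix (Fin 2) (Fin 2) ℂ)ˣ) : Matrix (Fin 2) (Fin 2) ℂ) := by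
  funext A
  rw [frameTw_def, wrec_eq_vcov]

/-- **THE COMB FAMILY PASSES THROUGH THE BASE POINT**: `pull (e^{0}) x₀ = 1` — §3's hypothesis `U₁ a = 1` at `a = 0`. [cite: Balaban1985Averaging, (8) p.19] -/
theorem comb_family_zero :
    pull (fun b => expUnit ((0 : PBond (F.P K) 0 → Matrix (Fin 2) (Fin 2) ℂ) b)) (basePt F n K) = 1 := by
  funext z κ
  apply Units.ext
  simp [pull, B7Prop1Explicit.val_expUnit]

/-- ★ **px13's (ii), COMB — THE TOP OF THE RECURSION IS R0-DOOR's LINEAR PART `hrc`**: `fderiv ℂ (A ↦ ↑(frameTw F n K h W A y)) 0` IS the derivative at `0` of §3's level-`(K − n)` comb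
frame of the family `A ↦ pull (e^{A}) x₀` at `coordT3 y`; so the `j = K − n` instance of a recursion whose linear parts are the `fderiv`s (§3 `fderiv_coe_vcov_succ_apply`) lands on
✓`Prop7R0OfFrameRows.siteRow_of_frameRows`' row `hrc` by `rw`. [cite: Balaban1985Averaging, (97) p.32; Balaban1985BackgroundPropagators, (3.14) p.393] -/
theorem fderiv_frameTw_eq_fderiv_vcov (W : GaugeField (F.P K) 0 (Matrix.specialUnitaryGroup (Fin 2) ℂ)) (y : Site (F.P n) 0) :
    fderiv ℂ (fun A : PBond (F.P K) 0 → Matrix (Fin 2) (Fin 2) ℂ => ((frameTw F n K h W A y : (Matrix (Fin 2) (Fin 2) ℂ)ˣ) : Matrix (Fin 2) (Fin 2) ℂ)) 0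
      = fderiv ℂ (fun A : PBond (F.P K) 0 → Matrix (Fin 2) (Fin 2) ℂ =>
          ((vcov (F.P K).L (pull (bgUnits F K W) (basePt F n K)) (pull (fun b => expUnit (A b)) (basePt F n K)) (K - n) (coordT3 F n K h y) :
            (Matrix (Fin 2) (Fin 2) ℂ)ˣ) : Matrix (Fin 2) (Fin 2) ℂ)) 0 := by
  rw [frameTw_family_eq]

/-- the `HasFDerivAt` transfer between the two spellings (any candidate derivative `r`, any base `A₀`). [cite: Balaban1985Averaging, (97) p.32] -/
theorem hasFDerivAt_frameTw_iff (W : GaugeField (F.P K) 0 (Matrix.specialUnitaryGroup (Fin 2) ℂ)) (y : Site (F.P n) 0)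
    (r : (PBond (F.P K) 0 → Matrix (Fin 2) (Fin 2) ℂ) →L[ℂ] Matrix (Fin 2) (Fin 2) ℂ) (A₀ : PBond (F.P K) 0 → Matrix (Fin 2) (Fin 2) ℂ) :
    HasFDerivAt (fun A : PBond (F.P K) 0 → Matrix (Fin 2) (Fin 2) ℂ => ((frameTw F n K h W A y : (Matrix (Fin 2) (Fin 2) ℂ)ˣ) : Matrix (Fin 2) (Fin 2) ℂ)) r A₀ ↔
      HasFDerivAt (fun A : PBond (F.P K) 0 → Matrix (Fin 2) (Fin 2) ℂ =>
          ((vcov (F.P K).L (pull (bgUnits F K W) (basePt F n K)) (pull (fun b => expUnit (A b)) (basePt F n K)) (K - n) (coordT3 F n K h y) :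
            (Matrix (Fin 2) (Fin 2) ℂ)ˣ) : Matrix (Fin 2) (Fin 2) ℂ)) r A₀ := by
  rw [frameTw_family_eq]

end Member

end Summit.QuantumFields.YangMills.Theorems.Prop7CombFrameLinearResponseStep

end
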